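import Literature.Algebra.Polynomial.LaplacianOrthogonalInvariance
import Mathlib
import HarnessLib

/-!
# Trigonal Injectivity — kernel-checked SUB-SKELETON (E-free, rational form) for the algebraic half of
`stub_oddModeRigidity` (:146 of `Cruxes/ShortRootRigidity/Lines/aperture_bootstrap.lean`, crux ⟨stmt-QuantumFields-23035⟩)

Paper proof: `Cruxes/ShortRootRigidity/TrigonalInjectivity.md` (§1, §1-bis, §1-ter; critic idea-crit-4 g10 adversarial PASS).
This file types the proof as FOUR stubs (each ≤ M−) + the PROVED arithmetic anchor + the PROVED composition
`trigonalInjectivityQ_of_stubs : 1 ≤ s → TrigonalInjectivityQ s`.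

E-FREE RATIONAL STATEMENT.  `TrigonalInjectivityQ s`: a real polynomial `Y(x,y,z)`, homogeneous of degree `6s`, harmonic,
invariant under the full octahedral group `O_h` (coordinate permutations and sign flips), whose composition with the projection
`proj = 1 − J/3` onto the plane `x+y+z = 0` is again harmonic («the trace on `Π_{(1,1,1)}` is planar-harmonic = sectoral»), is zero.
(`TorusReduction` feeds exactly this: at the induction step the top component has vanishing even trigonal weights `|q| < 6s`, its
odd weights vanish on the plane, so its trace is sectoral, i.e. planar-harmonic.)  No angles, no `ζ`, no amplitude in the statement.

HONEST LABEL: stubs carry `sorry`; the composition and the arithmetic are kernel-checked.  `OddModeRigidity`, ⟨23035⟩, ⟨23125⟩,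
R2d are OPEN; the Yang–Mills mass gap is NOT proved; no summit is proved by a line.
-/

noncomputable section

open MvPolynomial
open scoped BigOperators
open Literature.Algebra.Polynomial

namespace Summit.QuantumFields.YangMills.Cruxes.ShortRootRigidity.TrigonalLine

abbrev P3 := MvPolynomial (Fin 3) ℝ

/-- polynomial Laplacian on `ℝ[x,y,z]` -/
def lap (Y : P3) : P3 := ∑ i : Fin 3, pderiv i (pderiv i Y)

/-- the all-ones matrix `J` -/
def J3 : Matrix (Fin 3) (Fin 3) ℝ := Matrix.of fun _ _ => 1
/-- projection onto the plane `x+y+z=0` along `(1,1,1)`:  `1 − J/3` -/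
def Pm : Matrix (Fin 3) (Fin 3) ℝ := 1 - (1/3 : ℝ) • J3
/-- reflection in the plane `x+y+z=0`:  `σ = 1 − 2J/3` (orthogonal, rational) -/
def Rf : Matrix (Fin 3) (Fin 3) ℝ := 1 - (2/3 : ℝ) • J3
/-- sign flip of coordinate `i` -/
def flipMat (i : Fin 3) : Matrix (Fin 3) (Fin 3) ℝ := Matrix.diagonal fun j => if j = i then -1 else 1

/-- full octahedral invariance `O_h = S₃ ⋉ {±1}³` -/
def OhInvariant (Y : P3) : Prop :=
  (∀ σ : Equiv.Perm (Fin 3), rename σ Y = Y) ∧ (∀ i : Fin 3, bind₁ (linSubst (flipMat i)) Y = Y)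

/-- THE TARGET (E-free rational Trigonal Injectivity at level `s`). -/
def TrigonalInjectivityQ (s : ℕ) : Prop :=
  ∀ Y : P3, Y.IsHomogeneous (6 * s) → lap Y = 0 → OhInvariant Y → lap (bind₁ (linSubst Pm) Y) = 0 → Y = 0

/-! ## The model sectoral polynomial `E_s = Re λ^{6s}`, `λ = (x−z)/2 + i (x−2y+z)/(2√3)` — rational: only `β² = (x−2y+z)²/12` occurs. -/

/-- `α = (x − z)/2` -/
def alpha : P3 := C (1/2 : ℝ) * (X 0 - X 2)
/-- `β² = (x − 2y + z)²/12` -/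
def betaSq : P3 := C (1/12 : ℝ) * (X 0 - C (2:ℝ) * X 1 + X 2) ^ 2
/-- `E_s(x,y,z) = Σ_k (−1)^k C(6s,2k) α^{6s−2k} (β²)^k = Re (α + iβ)^{6s}` -/
def Esect (s : ℕ) : P3 :=
  ∑ k ∈ Finset.range (3 * s + 1), C ((-1 : ℝ) ^ k * ((6 * s).choose (2 * k) : ℝ)) * alpha ^ (6 * s - 2 * k) * betaSq ^ k

/-! ## Arithmetic anchor (PROVED; = `Cruxes/ShortRootRigidity/TrigonalArithmetic.lean`) -/

/-- integer coordinates of `(2 + √−3)^n = (ab n).1 + (ab n).2 · √−3` -/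
def ab : ℕ → ℤ × ℤ
  | 0 => (1, 0)
  | n + 1 => (2 * (ab n).1 - 3 * (ab n).2, (ab n).1 + 2 * (ab n).2)

def abMod : ℕ → ZMod 7 × ZMod 7
  | 0 => (1, 0)
  | n + 1 => (2 * (abMod n).1 - 3 * (abMod n).2, (abMod n).1 + 2 * (abMod n).2)

theorem abMod_eq_cast (n : ℕ) :
    abMod n = ((((ab n).1 : ℤ) : ZMod 7), (((ab n).2 : ℤ) : ZMod 7)) := by
  induction n with
  | zero => rfl
  | succ k ih =>
      show (2 * (abMod k).1 - 3 * (abMod k).2, (abMod k).1 + 2 * (abMod k).2)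
        = ((((2 * (ab k).1 - 3 * (ab k).2 : ℤ)) : ZMod 7), (((ab k).1 + 2 * (ab k).2 : ℤ) : ZMod 7))
      rw [ih]
      ext <;> push_cast <;> ring

theorem abMod_four : abMod 4 = abMod 1 := by decide

theorem abMod_periodic (k : ℕ) : abMod (k + 4) = abMod (k + 1) := by
  induction k with
  | zero => exact abMod_four
  | succ k ih =>
      show (2 * (abMod (k + 4)).1 - 3 * (abMod (k + 4)).2, (abMod (k + 4)).1 + 2 * (abMod (k + 4)).2)
        = (2 * (abMod (k + 1)).1 - 3 * (abMod (k + 1)).2, (abMod (k + 1)).1 + 2 * (abMod (k + 1)).2)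
      rw [ih]

theorem abMod_add_three_mul (k m : ℕ) : abMod (k + 1 + 3 * m) = abMod (k + 1) := by
  induction m with
  | zero => simp
  | succ m ih =>
      have h : k + 1 + 3 * (m + 1) = (k + 3 * m) + 4 := by ring
      rw [h, abMod_periodic, show k + 3 * m + 1 = k + 1 + 3 * m by ring, ih]

theorem abMod_three : abMod 3 = (4, 2) := by decide

theorem abMod_six_mul (s : ℕ) (hs : 1 ≤ s) : abMod (6 * s) = (4, 2) := by
  obtain ⟨t, rfl⟩ := Nat.exists_eq_add_of_le hs
  have h : 6 * (1 + t) = 2 + 1 + 3 * (2 * t + 1) := by ring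
  rw [h, abMod_add_three_mul]
  exact abMod_three

/-- `A_s = Re (2+√−3)^{6s}` as a real number -/
def Aval (s : ℕ) : ℝ := ((ab (6 * s)).1 : ℝ)

/-- `A_s ≠ 1` (indeed `A_s ≡ 4 (mod 7)`). PROVED. -/
theorem Aval_ne_one (s : ℕ) (hs : 1 ≤ s) : Aval s ≠ 1 := by
  intro h1
  have h1' : (ab (6 * s)).1 = 1 := by
    unfold Aval at h1
    exact_mod_cast h1
  have hmod := abMod_six_mul s hs
  rw [abMod_eq_cast, h1'] at hmod
  have h4 : ((1 : ℤ) : ZMod 7) = 4 := (Prod.mk.inj hmod).1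
  revert h4
  decide

/-! ## The four stubs (each a lemma of the paper proof; sizes S … M−) -/

/-- STUB L1 (M−) — ALGEBRAIC SCHWARZ REFLECTION.  `v := Y + Y∘σ − 2·Y∘proj` is harmonic (`σ` orthogonal:
`laplacian_bind₁_linSubst`; `Y∘proj` harmonic by hypothesis), `σ`-even, and vanishes on the plane (`σ = proj = id` there);
even + vanishing ⇒ `(x+y+z)² ∣ v`; a harmonic polynomial divisible by the square of a linear form is `0`
(`v = λ^k w`, `k ≥ 2` maximal ⇒ `0 = Δv = λ^{k−2}[k(k−1)|n|² w + λ(…)]` ⇒ `λ ∣ w`).  [TrigonalInjectivity.md §1-bis (2′)] -/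
theorem stub_reflection (Y : P3) (hh : lap Y = 0) (hp : lap (bind₁ (linSubst Pm) Y) = 0) :
    Y + bind₁ (linSubst Rf) Y = C (2 : ℝ) * bind₁ (linSubst Pm) Y := by
  sorry

/-- STUB L2 (M−) — SECTORAL SPAN.  `Y∘proj` is harmonic, constant along `(1,1,1)`, homogeneous of degree `6s` and inherits the
`D₆`-symmetry of the plane from `O_h`; in the plane chart its Laplacian is `(2/3)(∂uu − ∂uv + ∂vv)`, whose homogeneous solutions of
degree `n` form a 2-dimensional space `{Re c(u − ζv)^n}`; the transposition `x ↔ y` fixes `Re(u−ζv)^{6s}` and negates `Im(u−ζv)^{6s}`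
(because `(−ζ)^{6s} = 1`), so `Y∘proj = a·E_s`.  [§1 (1), §1-bis] -/
theorem stub_sectoralSpan (s : ℕ) (hs : 1 ≤ s) (Y : P3) (hY : Y.IsHomogeneous (6 * s)) (hO : OhInvariant Y)
    (hp : lap (bind₁ (linSubst Pm) Y) = 0) : ∃ a : ℝ, bind₁ (linSubst Pm) Y = a • Esect s := by
  sorry

/-- STUB L3 (S…M−) — THE THREE INTEGER VALUES.  `E_s(2,1,−3) = E_s(−2,3,−1) = A_s` and `E_s(0,−1,1) = 1`: at these points
`λ = (5+√−3)/2 = u·π̄`, `λ = (−1+3√−3)/2 = u′·π`, `λ = ζ^{±1}` with `u⁶ = u′⁶ = 1`, `π = 2+√−3`, so `Re λ^{6s} = Re π^{6s} = (ab (6s)).1`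
resp. `1`; bridge by the induction `π^n = (ab n).1 + (ab n).2·√−3` (checked exactly for `s ≤ 4`).  [§1-bis (4′)] -/
theorem stub_EsectValues (s : ℕ) (hs : 1 ≤ s) :
    eval ![2, 1, -3] (Esect s) = Aval s ∧ eval ![-2, 3, -1] (Esect s) = Aval s ∧ eval ![0, -1, 1] (Esect s) = 1 := by
  sorry

/-- STUB L4 (M−) — THE FINISH.  If `Y` is `σ`-odd then (transport by `O_h`) it is odd under the reflections in two diagonal planes,
hence invariant under their product `R`, a rational rotation about `e ∥ (−1,1,0)` with `cos α = −7/9` of infinite order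
(`u_m = 9^m cos(mα)`, `u_{m+1} = −14u_m − 81u_{m−1}`, `u_m ≡ 2 (mod 3)` for `m ≥ 1`); so `Y` is zonal about `e`, by `O_h` zonal about
`(1,1,0)` too, hence `Y = c·(x²+y²+z²)^{3s}`, and harmonicity forces `c = 0`.  [§1-bis (7′), §1-ter (β)] -/
theorem stub_finish (s : ℕ) (hs : 1 ≤ s) (Y : P3) (hY : Y.IsHomogeneous (6 * s)) (hh : lap Y = 0) (hO : OhInvariant Y)
    (hodd : bind₁ (linSubst Rf) Y = -Y) : Y = 0 := by
  sorry

/-! ## Matrix-vector facts at the magic point `P = (2,1,3)` (PROVED) -/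

theorem Rf_mulVec_P : Rf.mulVec ![2, 1, 3] = ![-2, -3, -1] := by
  ext i; fin_cases i <;> simp [Rf, J3, Matrix.mulVec, dotProduct, Fin.sum_univ_three, Matrix.one_apply, Matrix.sub_apply,
    Matrix.smul_apply] <;> norm_num

theorem Pm_mulVec_P : Pm.mulVec ![2, 1, 3] = ![0, -1, 1] := by
  ext i; fin_cases i <;> simp [Pm, J3, Matrix.mulVec, dotProduct, Fin.sum_univ_three, Matrix.one_apply, Matrix.sub_apply,
    Matrix.smul_apply] <;> norm_num

theorem Pm_mulVec_of_plane (p : Fin 3 → ℝ) (hp : p 0 + p 1 + p 2 = 0) : Pm.mulVec p = p := by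
  ext i; fin_cases i <;> simp [Pm, J3, Matrix.mulVec, dotProduct, Fin.sum_univ_three, Matrix.one_apply, Matrix.sub_apply,
    Matrix.smul_apply] <;> linarith

theorem flip2_mulVec_P : (flipMat 2).mulVec ![2, 1, 3] = ![2, 1, -3] := by
  ext i; fin_cases i <;> simp [flipMat, Matrix.mulVec_diagonal]

theorem flip1_mulVec_Q : (flipMat 1).mulVec ![-2, -3, -1] = ![-2, 3, -1] := by
  ext i; fin_cases i <;> simp [flipMat, Matrix.mulVec_diagonal]

/-- value of `Y` at a point `p` of the plane, read through `Y∘proj = a·E_s` -/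
theorem eval_plane_of_span {s : ℕ} {Y : P3} {a : ℝ} (ha : bind₁ (linSubst Pm) Y = a • Esect s)
    (p : Fin 3 → ℝ) (hp : p 0 + p 1 + p 2 = 0) : eval p Y = a * eval p (Esect s) := by
  have h := congrArg (eval p) ha
  rw [eval_bind₁_linSubst, Pm_mulVec_of_plane p hp, smul_eval] at h
  exact h

/-! ## The composition (PROVED): stubs L1–L4 + anchor ⇒ `TrigonalInjectivityQ s` -/

theorem trigonalInjectivityQ_of_stubs (s : ℕ) (hs : 1 ≤ s) : TrigonalInjectivityQ s := by
  intro Y hY hh hO hp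
  obtain ⟨a, ha⟩ := stub_sectoralSpan s hs Y hY hO hp
  obtain ⟨hvP, hvQ, hv0⟩ := stub_EsectValues s hs
  have hR := stub_reflection Y hh hp
  -- (R) evaluated at the magic point P = (2,1,3):  Y(P) + Y(Q) = 2·Y(0,−1,1)
  have e1 := congrArg (eval ![(2:ℝ), 1, 3]) hR
  rw [map_add, map_mul, eval_C, eval_bind₁_linSubst, eval_bind₁_linSubst, Rf_mulVec_P, Pm_mulVec_P] at e1
  -- transport P and Q into the plane Π_{(1,1,1)} by sign flips
  have eP : eval ![(2:ℝ), 1, 3] Y = eval ![(2:ℝ), 1, -3] Y := by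
    have h := congrArg (eval ![(2:ℝ), 1, 3]) (hO.2 2)
    rw [eval_bind₁_linSubst, flip2_mulVec_P] at h
    exact h.symm
  have eQ : eval ![(-2:ℝ), -3, -1] Y = eval ![(-2:ℝ), 3, -1] Y := by
    have h := congrArg (eval ![(-2:ℝ), -3, -1]) (hO.2 1)
    rw [eval_bind₁_linSubst, flip1_mulVec_Q] at h
    exact h.symm
  -- the three values through the sectoral span
  have vP : eval ![(2:ℝ), 1, -3] Y = a * Aval s := by
    rw [eval_plane_of_span ha _ (by simp; norm_num), hvP]
  have vQ : eval ![(-2:ℝ), 3, -1] Y = a * Aval s := by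
    rw [eval_plane_of_span ha _ (by simp; norm_num), hvQ]
  have v0 : eval ![(0:ℝ), -1, 1] Y = a * 1 := by
    rw [eval_plane_of_span ha _ (by simp), hv0]
  rw [eP, eQ, vP, vQ, v0] at e1
  -- e1 : a * A + a * A = 2 * (a * 1)  ⇒  a (A − 1) = 0  ⇒  a = 0
  have ha0 : a = 0 := by
    have hstar : a * (Aval s - 1) = 0 := by linarith
    rcases mul_eq_zero.mp hstar with h | h
    · exact h
    · exact absurd (by linarith : Aval s = 1) (Aval_ne_one s hs)
  -- hence Y∘proj = 0, so (R) says Y is σ-odd, and the finish applies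
  rw [ha0, zero_smul] at ha
  rw [ha, mul_zero] at hR
  exact stub_finish s hs Y hY hh hO (by linear_combination hR)

end Summit.QuantumFields.YangMills.Cruxes.ShortRootRigidity.TrigonalLine
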